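import Literature.NumberTheory.GaloisRepresentations.RestrictedRamificationOpenSubgroupLayers
import Literature.NumberTheory.GaloisRepresentations.SUnitsValuation
import Literature.Algebra.Homology.DiscreteRepLayerColimitDivisibility
import HarnessLib

/-!
# The layers of `E_S = 𝒪_{K_S,S}ˣ` over an open `U = Gal(K_S/F₀) ≤ G_{K,S}` ARE the `Gal(E/F₀)`-modules
# `𝒪_{E,S}ˣ`: `Hⁿ(U ⧸ Gal(K_S/E), E_S^{Gal(K_S/E)}) ≅ Hⁿ(Gal(E/F₀), 𝒪_{E,S}ˣ)` (NSW VIII §3: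
# `Hʳ(G_S(F₀), E_S) = lim→_E Hʳ(Gal(E/F₀), 𝒪_{E,S}^×)`)

Topic `NumberTheory/GaloisRepresentations`; namespace
`Literature.NumberTheory.GaloisRepresentations.SUnits.Layers`.  Definitions with bodies (the layer module
isomorphism and the induced isomorphism on group cohomology — plumbing) and theorems; NO named fact, no `sorry`,
no instance, no notation.  Sequel of `SUnitsGaloisModule` (A1: `sUnits`, `sUnitsRep`, `sUnitsModule`,
`sUnitsRestricted`), `SUnitsValuation` (A1b), `RestrictedRamificationOpenSubgroupLayers` (A2-β1: `toAbove`,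
`baseField`, `algOfLE`, `layerHom`, `layerSubgroup`, `layerEquiv`, `exists_layerSubgroup_le`) and
`Algebra/Homology/DiscreteRepLayerColimitDivisibility` (A2-α).

SETTING (as in (A2-β1)): `K` a number field, `S` a set of finite places, `H ≤ Γ_K` open with `N_S ≤ H`,
`U := galoisGroupAbove S H`, `F₀ := baseField H = K̄^H`; `D := sUnitsRestricted K S` restricted to `↥U`
(`resRep`), `X := resRep.toTopRep`, `M := stdBase X _ ∈ C_{↥U}`.  For a layer `E` (`IdeleClassBar.GalLayer K`,
`hF : baseField H ≤ E.1`, `hS : N_S ≤ galFixing K E.1`) with layer subgroup `V̄_E = layerSubgroup S hHo E hF hS`: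

* §1 `val`: the underlying element of `K̄` of a vector of `D`; the action formula
  `val (resRep (toAbove σ) w) = σ • val w`;
* §2 **`layerModuleEquiv : (M^{V̄_E}).V ≃ₗ[ℤ] Additive ↥(sUnits K S ↥E.1)`** — a `V̄_E`-invariant `S`-unit of `K_S`
  lies in `E = K̄^{Gal(K̄/E)}` (infinite Galois theory) and is an `S`-unit of `E` over `K` (`map_mem_sUnits_iff`);
  conversely an `S`-unit of `E` is an `N_S`- and `V̄_E`-invariant `S`-unit of `K̄`; equivariance along
  `layerEquiv : ↥U ⧸ V̄_E ≃* Gal(E/F₀)` (`layerModuleEquiv_comm`);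
* §3 **`layerCohomologyIso E n : Hⁿ(↥U ⧸ V̄_E, M^{V̄_E}) ≅ Hⁿ(Gal(E/F₀), sUnitsRep K S F₀ E)`**
  (Mathlib `groupCohomology.mapIso`).

(Transitions and the discharge of the layer hypotheses of (A2-α) are the sequel `SUnitsRestrictedLayersInflation`.)
Lane «PT3-TC» of cell `bsd-eis` (crux `GoodLatticeBDPValue`, stmt-BirchSwinnertonDyer-19032; road memo `PT3TC-ROAD.md`,
brick (A2-β2), part 1).

## References
* J. Neukirch, A. Schmidt, K. Wingberg, *Cohomology of Number Fields*, 2nd ed. (2008), VIII §3 (`E_S = lim→ 𝒪_{K,S}^×`,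
  `G_S(K)`), (1.5.1), proof of (8.3.18). [NeukirchSchmidtWingberg2008]
* J.-P. Serre, *Cohomologie galoisienne* (1994), I §2.2 Prop. 8. [SerreGaloisCohomology1997]
* D. Harari, *Galois Cohomology and Class Field Theory* (2020), §4.3 Remark 4.24, §13.1. [Harari2020]
-/

noncomputable section

open NumberField IsDedekindDomain Field Topology CategoryTheory
open Literature.NumberTheory.GaloisRepresentations.IdeleClassBar (GalLayer)
open Literature.NumberTheory.GaloisRepresentations.LocalWeilDatum (galFixing mem_galFixing_iff)
open Literature.NumberTheory.IwasawaTheory.Greenberg2006 (galoisGroupAbove)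
open Literature.Algebra.Homology Literature.Algebra.Homology.DiscreteRep

namespace Literature.NumberTheory.GaloisRepresentations

namespace SUnits

namespace Layers

open DiscreteGaloisModule

variable (K : Type) [Field K] [NumberField K] (S : Set (HeightOneSpectrum (𝓞 K)))
  (H : Subgroup (absoluteGaloisGroup K))

/-! ### §0. The objects -/

/-- **`E_S` restricted to the open subgroup `U = galoisGroupAbove S H ≤ G_{K,S}`** (`Res_U (sUnitsRestricted K S)`).
[cite: NeukirchSchmidtWingberg2008, VIII §3 (`G_S(K)`, `E_S`)] -/
abbrev resRep :
    ContinuousRep ↥(galoisGroupAbove S H) ℤ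
      (Representation.invariants ((sUnitsModule K S).toRepresentation.comp (ramificationSubgroup K S).subtype)) :=
  (sUnitsRestricted K S).restrict (subgroupIncl (galoisGroupAbove S H))

/-- `Res_U E_S` has open stabilisers (it is a continuous representation on a discrete module).
[cite: SerreGaloisCohomology1997, I §2.1] -/
theorem isDiscrete_resRep : IsDiscrete ((forgetTop ℤ ↥(galoisGroupAbove S H)).obj (resRep K S H).toTopRep) :=
  isDiscrete_of_continuousRep (resRep K S H)

/-- An open subgroup `U = H/N_S` of the compact `G_{K,S}` is compact. [cite: SerreGaloisCohomology1997, I §1.1] -/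
theorem compactSpace_above (hHo : IsOpen (H : Set (absoluteGaloisGroup K))) : CompactSpace ↥(galoisGroupAbove S H) := by
  have hO : IsOpen ((galoisGroupAbove S H : Subgroup (GaloisGroupUnramifiedOutside K S)) :
      Set (GaloisGroupUnramifiedOutside K S)) := by
    rw [galoisGroupAbove, Subgroup.coe_map]
    exact isOpenMap_toUnramifiedQuot K S _ hHo
  exact isCompact_iff_compactSpace.mp (Subgroup.isClosed_of_isOpen _ hO).isCompact

/-- **`Res_U E_S` as an object of door-c4's category `C_{↥U}`** (`stdBase`, so that the comparison `Φ` and the layer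
colimit theorems apply verbatim). [cite: Harari2020, §4.3 Remark 4.24] -/
def resD (hHo : IsOpen (H : Set (absoluteGaloisGroup K))) : DiscreteRepCat ℤ ↥(galoisGroupAbove S H) :=
  haveI := compactSpace_above K S H hHo
  stdBase (resRep K S H).toTopRep (isDiscrete_resRep K S H)

/-- `resD` is `stdBase` (unfolding, with the compactness instance supplied). [cite: Harari2020, §4.3 Remark 4.24] -/
theorem resD_eq (hHo : IsOpen (H : Set (absoluteGaloisGroup K))) :
    resD K S H hHo = (haveI := compactSpace_above K S H hHo; stdBase (resRep K S H).toTopRep (isDiscrete_resRep K S H)) :=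
  rfl

/-- The action of the object `resD` is that of `resRep` (unfolding). [cite: Harari2020, §4.3 Remark 4.24] -/
theorem resD_ρ_apply (hHo : IsOpen (H : Set (absoluteGaloisGroup K))) (u : ↥(galoisGroupAbove S H))
    (w : Representation.invariants ((sUnitsModule K S).toRepresentation.comp (ramificationSubgroup K S).subtype)) :
    (resD K S H hHo).obj.ρ u w = resRep K S H u w := rfl

variable {K S H}

/-! ### §1. Underlying elements of `K̄` and the action -/

/-- The underlying unit of `K̄` of a vector of `E_S`. [cite: NeukirchSchmidtWingberg2008, VIII §3] -/
abbrev unitOf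
    (w : Representation.invariants ((sUnitsModule K S).toRepresentation.comp (ramificationSubgroup K S).subtype)) :
    (AlgebraicClosure K)ˣ :=
  (UnitsCarrier.toAdditive ((w : sUnitsSubmodule K S) : UnitsCarrier K)).toMul

/-- The underlying unit is an `S`-unit of `K̄` over `K`. [cite: NeukirchSchmidtWingberg2008, VIII §3] -/
theorem unitOf_mem_sUnits
    (w : Representation.invariants ((sUnitsModule K S).toRepresentation.comp (ramificationSubgroup K S).subtype)) :
    unitOf w ∈ sUnits K S (AlgebraicClosure K) :=
  (mem_sUnitsSubmodule_iff K S _).1 (w : sUnitsSubmodule K S).2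

/-- Two vectors of `E_S` with the same underlying unit are equal. [cite: NeukirchSchmidtWingberg2008, VIII §3] -/
theorem unitOf_injective :
    Function.Injective (unitOf (K := K) (S := S)) := fun w w' h => by
  apply Subtype.ext
  apply Subtype.ext
  exact UnitsCarrier.toAdditive.injective (Additive.toMul.injective h)

/-- **The action of `σ N_S` on `E_S` is `σ` on underlying units.** [cite: NeukirchSchmidtWingberg2008, VIII §3] -/
theorem unitOf_sUnitsRestricted (σ : absoluteGaloisGroup K)
    (w : Representation.invariants ((sUnitsModule K S).toRepresentation.comp (ramificationSubgroup K S).subtype)) :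
    unitOf (sUnitsRestricted K S (toUnramifiedQuot K S σ) w) = σ • unitOf w := by
  change (UnitsCarrier.toAdditive (((sUnitsRestricted K S (σ : GaloisGroupUnramifiedOutside K S) w :
      Representation.invariants _) : sUnitsSubmodule K S) : UnitsCarrier K)).toMul = _
  rw [sUnitsRestricted_apply_coe, sUnitsModule_apply_coe, units_apply_apply]
  rfl

/-- The action of `toAbove σ ∈ U` on `Res_U E_S` is `σ` on underlying units.
[cite: NeukirchSchmidtWingberg2008, VIII §3] -/
theorem unitOf_resRep_toAbove (σ : H)
    (w : Representation.invariants ((sUnitsModule K S).toRepresentation.comp (ramificationSubgroup K S).subtype)) :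
    unitOf (resRep K S H (OpenSubgroupLayer.toAbove S H σ) w) = (σ : absoluteGaloisGroup K) • unitOf w :=
  unitOf_sUnitsRestricted (σ : absoluteGaloisGroup K) w

/-- `Gal(K̄/E) ≤ H` when `F₀ = K̄^H ≤ E` (`H` open, hence closed). [cite: NeukirchANT1999, Ch. IV (1.2)] -/
theorem galFixing_le (hHo : IsOpen (H : Set (absoluteGaloisGroup K))) (E : GalLayer K)
    (hF : OpenSubgroupLayer.baseField H ≤ E.1) : galFixing K E.1 ≤ H := fun _ hσ =>
  OpenSubgroupLayer.mem_of_forall_smul_eq_self H (Subgroup.isClosed_of_isOpen H hHo) fun x hx =>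
    (mem_galFixing_iff K).1 hσ x (hF hx)

/-! ### §2. The layer module `(Res_U E_S)^{Gal(K_S/E)} ≃ₗ[ℤ] 𝒪_{E,S}ˣ` -/

/-- **The layer object `(Res_U E_S)^{V̄_E}` of door-c4's system** at the layer subgroup `V̄_E = Gal(K_S/E)`
(`invariantsQuotFunctor`; an abbreviation so that `stepG`, `inflG`, `stdBase` apply verbatim).
[cite: SerreGaloisCohomology1997, I §2.2 Prop. 8] -/
abbrev layerRep (hHo : IsOpen (H : Set (absoluteGaloisGroup K))) (E : GalLayer K)
    (hF : OpenSubgroupLayer.baseField H ≤ E.1) (hS : ramificationSubgroup K S ≤ galFixing K E.1) :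
    Rep ℤ (↥(galoisGroupAbove S H) ⧸
      ((OpenSubgroupLayer.layerSubgroup S hHo E hF hS : OpenNormalSubgroup ↥(galoisGroupAbove S H)) :
        Subgroup ↥(galoisGroupAbove S H))) :=
  (invariantsQuotFunctor ℤ
    ((OpenSubgroupLayer.layerSubgroup S hHo E hF hS : OpenNormalSubgroup ↥(galoisGroupAbove S H)) :
      Subgroup ↥(galoisGroupAbove S H))).obj (resD K S H hHo)

section LayerModule

variable (hHo : IsOpen (H : Set (absoluteGaloisGroup K))) (E : GalLayer K)
  (hF : OpenSubgroupLayer.baseField H ≤ E.1) (hS : ramificationSubgroup K S ≤ galFixing K E.1)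

include hF in
/-- A `Gal(K_S/E)`-invariant vector of `E_S` is fixed by `Gal(K̄/E)` on underlying units.
[cite: NeukirchSchmidtWingberg2008, VIII §3] -/
theorem smul_unitOf_eq_of_mem (z : (layerRep hHo E hF hS).V) {σ : absoluteGaloisGroup K}
    (hσ : σ ∈ galFixing K E.1) : σ • unitOf (K := K) (S := S) z.1 = unitOf z.1 := by
  have hσH : σ ∈ H := galFixing_le hHo E hF hσ
  have hu : OpenSubgroupLayer.toAbove S H ⟨σ, hσH⟩ ∈ OpenSubgroupLayer.layerSubgroup S hHo E hF hS :=
    (OpenSubgroupLayer.toAbove_mem_layerSubgroup_iff S hHo E hF hS ⟨σ, hσH⟩).2 hσ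
  have h1 : resRep K S H (OpenSubgroupLayer.toAbove S H ⟨σ, hσH⟩) z.1 = z.1 :=
    z.2 ⟨OpenSubgroupLayer.toAbove S H ⟨σ, hσH⟩, hu⟩
  have h2 := unitOf_resRep_toAbove ⟨σ, hσH⟩ z.1
  rw [h1] at h2
  exact h2.symm

/-- The underlying element of `K̄` of a `Gal(K_S/E)`-invariant vector of `E_S` lies in `E`
(`K̄^{Gal(K̄/E)} = E`). [cite: NeukirchANT1999, Ch. IV (1.2)] -/
theorem coe_unitOf_mem (z : (layerRep hHo E hF hS).V) :
    ((unitOf (K := K) (S := S) z.1 : (AlgebraicClosure K)ˣ) : AlgebraicClosure K) ∈ E.1 := by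
  rw [← InfiniteGalois.fixedField_fixingSubgroup E.1, IntermediateField.mem_fixedField_iff]
  intro σ hσ
  have hσ' : (absoluteGaloisGroup.toAlgEquiv K).symm σ ∈ galFixing K E.1 :=
    (mem_galFixing_iff K).2 fun x hx => (IntermediateField.mem_fixingSubgroup_iff _ _).1 hσ x hx
  have h := congrArg (fun u : (AlgebraicClosure K)ˣ => (u : AlgebraicClosure K))
    (smul_unitOf_eq_of_mem hHo E hF hS z hσ')
  exact h

/-- The inverse also lies in `E`. [cite: NeukirchANT1999, Ch. IV (1.2)] -/
theorem coe_inv_unitOf_mem (z : (layerRep hHo E hF hS).V) :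
    (((unitOf (K := K) (S := S) z.1)⁻¹ : (AlgebraicClosure K)ˣ) : AlgebraicClosure K) ∈ E.1 := by
  rw [Units.val_inv_eq_inv_val]
  exact inv_mem (coe_unitOf_mem hHo E hF hS z)

/-- The `S`-unit of `E` underlying a `Gal(K_S/E)`-invariant vector of `E_S`.
[cite: NeukirchSchmidtWingberg2008, VIII §3] -/
def toLayerUnit (z : (layerRep hHo E hF hS).V) : sUnits K S ↥E.1 :=
  ⟨⟨⟨_, coe_unitOf_mem hHo E hF hS z⟩, ⟨_, coe_inv_unitOf_mem hHo E hF hS z⟩,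
      Subtype.ext (Units.mul_inv _), Subtype.ext (Units.inv_mul _)⟩,
    (map_mem_sUnits_iff (IsScalarTower.toAlgHom K (↥E.1) (AlgebraicClosure K)) _).1 (by
      convert unitOf_mem_sUnits z.1 using 1
      exact Units.ext rfl)⟩

/-- Formula: the `K̄`-value of `toLayerUnit z` is the underlying unit of `z`.
[cite: NeukirchSchmidtWingberg2008, VIII §3] -/
theorem coe_toLayerUnit (z : (layerRep hHo E hF hS).V) :
    ((((toLayerUnit hHo E hF hS z : sUnits K S ↥E.1) : (↥E.1)ˣ) : ↥E.1) : AlgebraicClosure K) =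
      (unitOf (K := K) (S := S) z.1 : AlgebraicClosure K) := rfl

/-- An `S`-unit of `E` (inside `K_S`), viewed in `K̄ˣ`, is an `N_S`-invariant `S`-unit: a vector of `E_S`.
[cite: NeukirchSchmidtWingberg2008, VIII §3] -/
def ofLayerUnitES (x : sUnits K S ↥E.1) :
    Representation.invariants ((sUnitsModule K S).toRepresentation.comp (ramificationSubgroup K S).subtype) :=
  ⟨⟨UnitsCarrier.toAdditive.symm (Additive.ofMul (Units.map (algebraMap ↥E.1 (AlgebraicClosure K) : ↥E.1 →* _)
      (x : (↥E.1)ˣ))), (mem_sUnitsSubmodule_iff K S _).2 (by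
        change Units.map _ _ ∈ sUnits K S (AlgebraicClosure K)
        exact map_mem_sUnits (IsScalarTower.toAlgHom K (↥E.1) (AlgebraicClosure K)) x.2)⟩,
    fun g => by
      apply Subtype.ext
      apply UnitsCarrier.toAdditive.injective
      rw [MonoidHom.coe_comp, Function.comp_apply, Subgroup.coe_subtype, ContinuousRep.toRepresentation_apply,
        sUnitsModule_apply_coe, units_apply_apply]
      change Additive.ofMul ((g : absoluteGaloisGroup K) • Units.map _ (x : (↥E.1)ˣ)) = Additive.ofMul (Units.map _ _)
      refine congrArg Additive.ofMul (Units.ext ?_)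
      rw [Units.coe_smul, Units.coe_map]
      exact (mem_galFixing_iff K).1 (hS g.2) _ ((x : (↥E.1)ˣ) : ↥E.1).2⟩

/-- Formula: the underlying unit of `ofLayerUnitES x` is `x` viewed in `K̄ˣ`. [cite: NeukirchSchmidtWingberg2008, VIII §3] -/
theorem unitOf_ofLayerUnitES (x : sUnits K S ↥E.1) :
    unitOf (ofLayerUnitES E hS x) = Units.map (algebraMap ↥E.1 (AlgebraicClosure K) : ↥E.1 →* _) (x : (↥E.1)ˣ) :=
  rfl

/-- `toAbove σ` fixes `ofLayerUnitES x` for `σ ∈ Gal(K̄/E)`. [cite: NeukirchSchmidtWingberg2008, VIII §3] -/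
theorem resRep_toAbove_ofLayerUnitES {σ : H} (hσE : (σ : absoluteGaloisGroup K) ∈ galFixing K E.1)
    (x : sUnits K S ↥E.1) :
    resRep K S H (OpenSubgroupLayer.toAbove S H σ) (ofLayerUnitES E hS x) = ofLayerUnitES E hS x := by
  apply unitOf_injective
  rw [unitOf_resRep_toAbove, unitOf_ofLayerUnitES]
  refine Units.ext ?_
  rw [Units.coe_smul, Units.coe_map]
  exact (mem_galFixing_iff K).1 hσE _ ((x : (↥E.1)ˣ) : ↥E.1).2

/-- **`𝒪_{E,S}ˣ → (Res_U E_S)^{Gal(K_S/E)}`** (additive). [cite: NeukirchSchmidtWingberg2008, VIII §3] -/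
def ofLayerUnit : Additive (sUnits K S ↥E.1) →+ (layerRep hHo E hF hS).V :=
  AddMonoidHom.mk' (fun x => ⟨ofLayerUnitES E hS (Additive.toMul x), fun v => by
      obtain ⟨σ, hσ⟩ := OpenSubgroupLayer.toAbove_surjective S H (v : ↥(galoisGroupAbove S H))
      have hσE : (σ : absoluteGaloisGroup K) ∈ galFixing K E.1 :=
        (OpenSubgroupLayer.toAbove_mem_layerSubgroup_iff S hHo E hF hS σ).1 (hσ ▸ v.2)
      change resRep K S H (v : ↥(galoisGroupAbove S H)) (ofLayerUnitES E hS (Additive.toMul x)) = _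
      rw [← hσ]
      exact resRep_toAbove_ofLayerUnitES E hS hσE _⟩)
    fun x y => by
      apply Subtype.ext
      apply unitOf_injective
      change unitOf (ofLayerUnitES E hS (Additive.toMul (x + y))) =
        unitOf (ofLayerUnitES E hS (Additive.toMul x) + ofLayerUnitES E hS (Additive.toMul y))
      have hadd : unitOf (ofLayerUnitES E hS (Additive.toMul x) + ofLayerUnitES E hS (Additive.toMul y)) =
          unitOf (ofLayerUnitES E hS (Additive.toMul x)) * unitOf (ofLayerUnitES E hS (Additive.toMul y)) := rfl
      rw [hadd, unitOf_ofLayerUnitES, unitOf_ofLayerUnitES, unitOf_ofLayerUnitES, toMul_add, Subgroup.coe_mul, map_mul]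

/-- Formula: underlying unit of `ofLayerUnit x`. [cite: NeukirchSchmidtWingberg2008, VIII §3] -/
theorem unitOf_ofLayerUnit (x : Additive (sUnits K S ↥E.1)) :
    unitOf (K := K) (S := S) (ofLayerUnit hHo E hF hS x).1 =
      Units.map (algebraMap ↥E.1 (AlgebraicClosure K) : ↥E.1 →* _) ((Additive.toMul x : sUnits K S ↥E.1) : (↥E.1)ˣ) :=
  rfl

/-- `ofLayerUnit` is bijective (inverse `toLayerUnit`). [cite: NeukirchSchmidtWingberg2008, VIII §3] -/
theorem ofLayerUnit_bijective : Function.Bijective (ofLayerUnit hHo E hF hS) := by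
  constructor
  · intro x y hxy
    have h := congrArg (fun z : (layerRep hHo E hF hS).V => unitOf (K := K) (S := S) z.1) hxy
    simp only [unitOf_ofLayerUnit] at h
    have h' : (Additive.toMul x : sUnits K S ↥E.1) = Additive.toMul y := Subtype.ext
      (Units.ext (Subtype.ext (by
        exact congrArg (fun u : (AlgebraicClosure K)ˣ => (u : AlgebraicClosure K)) h)))
    exact Additive.toMul.injective h'
  · intro z
    refine ⟨Additive.ofMul (toLayerUnit hHo E hF hS z), Subtype.ext (unitOf_injective ?_)⟩
    exact Units.ext rfl

/-- **THE LAYER MODULE: `(Res_U E_S)^{Gal(K_S/E)} ≃ₗ[ℤ] 𝒪_{E,S}ˣ`** (additively; inverse of `ofLayerUnit`).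
[cite: NeukirchSchmidtWingberg2008, VIII §3 (`E_S = lim→ 𝒪_{K,S}^×`)] [cite: Harari2020, §13.1] -/
def layerModuleEquiv :
    letI := (layerRep hHo E hF hS).hV2
    (layerRep hHo E hF hS).V ≃ₗ[ℤ] Additive (sUnits K S ↥E.1) :=
  { (AddEquiv.ofBijective (ofLayerUnit hHo E hF hS) (ofLayerUnit_bijective hHo E hF hS)).symm with
    map_smul' := fun c z =>
      map_intCast_smul (AddEquiv.ofBijective (ofLayerUnit hHo E hF hS) (ofLayerUnit_bijective hHo E hF hS)).symm
        ℤ ℤ c z }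

/-- `layerModuleEquiv⁻¹ = ofLayerUnit`. [cite: NeukirchSchmidtWingberg2008, VIII §3] -/
theorem layerModuleEquiv_symm_apply (x : Additive (sUnits K S ↥E.1)) :
    (layerModuleEquiv hHo E hF hS).symm x = ofLayerUnit hHo E hF hS x :=
  (layerModuleEquiv hHo E hF hS).symm_apply_eq.2
    (((AddEquiv.ofBijective (ofLayerUnit hHo E hF hS) (ofLayerUnit_bijective hHo E hF hS)).symm_apply_apply x).symm.trans
      rfl)

/-- **The `K̄`-value of `layerModuleEquiv z` is the underlying unit of `z`.** [cite: NeukirchSchmidtWingberg2008, VIII §3] -/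
theorem coe_layerModuleEquiv (z : (layerRep hHo E hF hS).V) :
    ((((Additive.toMul (layerModuleEquiv hHo E hF hS z) : sUnits K S ↥E.1) : (↥E.1)ˣ) : ↥E.1) : AlgebraicClosure K) =
      (unitOf (K := K) (S := S) z.1 : AlgebraicClosure K) := by
  obtain ⟨x, rfl⟩ := (ofLayerUnit_bijective hHo E hF hS).2 z
  have h1 : layerModuleEquiv hHo E hF hS (ofLayerUnit hHo E hF hS x) = x := by
    rw [← layerModuleEquiv_symm_apply, LinearEquiv.apply_symm_apply]
  rw [h1]
  exact (Units.coe_map _ _).symm.trans (congrArg (fun u : (AlgebraicClosure K)ˣ => (u : AlgebraicClosure K))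
    (unitOf_ofLayerUnit hHo E hF hS x).symm)

/-- **Equivariance of the layer module along `layerEquiv : ↥U ⧸ V̄_E ≃* Gal(E/F₀)`**: for `g ∈ ↥U ⧸ V̄_E`,
`layerModuleEquiv ∘ (g • ·) = (layerEquiv g • ·) ∘ layerModuleEquiv` (both are `σ •` on `K̄`-values for a lift
`σ ∈ H` of `g`). [cite: NeukirchSchmidtWingberg2008, VIII §3] [cite: Harari2020, §13.1] -/
theorem layerModuleEquiv_comm
    (g : ↥(galoisGroupAbove S H) ⧸
      ((OpenSubgroupLayer.layerSubgroup S hHo E hF hS : OpenNormalSubgroup ↥(galoisGroupAbove S H)) :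
        Subgroup ↥(galoisGroupAbove S H))) :
    letI := OpenSubgroupLayer.algOfLE hF
    (layerModuleEquiv hHo E hF hS).toLinearMap ∘ₗ (layerRep hHo E hF hS).ρ g =
      (sUnitsRep K S ↥(OpenSubgroupLayer.baseField H) ↥E.1).ρ (OpenSubgroupLayer.layerEquiv S hHo E hF hS g) ∘ₗ
        (layerModuleEquiv hHo E hF hS).toLinearMap := by
  letI := OpenSubgroupLayer.algOfLE hF
  induction g using QuotientGroup.induction_on with
  | H u =>
    obtain ⟨σ, rfl⟩ := OpenSubgroupLayer.toAbove_surjective S H u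
    refine LinearMap.ext fun z => ?_
    -- compare `K̄`-values
    apply Additive.toMul.injective
    apply Subtype.ext
    apply Units.ext
    apply Subtype.ext
    have lhs : ((((Additive.toMul (layerModuleEquiv hHo E hF hS
        ((layerRep hHo E hF hS).ρ (QuotientGroup.mk (OpenSubgroupLayer.toAbove S H σ)) z)) :
        sUnits K S ↥E.1) : (↥E.1)ˣ) : ↥E.1) : AlgebraicClosure K) =
        (σ : absoluteGaloisGroup K) • ((unitOf (K := K) (S := S) z.1 : (AlgebraicClosure K)ˣ) : AlgebraicClosure K) := by
      rw [coe_layerModuleEquiv]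
      change ((unitOf (resRep K S H (OpenSubgroupLayer.toAbove S H σ) z.1) : (AlgebraicClosure K)ˣ) :
        AlgebraicClosure K) = _
      rw [unitOf_resRep_toAbove]
      rfl
    have rhs : ((((Additive.toMul ((sUnitsRep K S ↥(OpenSubgroupLayer.baseField H) ↥E.1).ρ
          (OpenSubgroupLayer.layerEquiv S hHo E hF hS (QuotientGroup.mk (OpenSubgroupLayer.toAbove S H σ)))
          (layerModuleEquiv hHo E hF hS z)) : sUnits K S ↥E.1) : (↥E.1)ˣ) : ↥E.1) : AlgebraicClosure K) =
        (σ : absoluteGaloisGroup K) • ((unitOf (K := K) (S := S) z.1 : (AlgebraicClosure K)ˣ) : AlgebraicClosure K) := by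
      rw [coe_toMul_sUnitsRep_ρ]
      change ((OpenSubgroupLayer.layerEquiv S hHo E hF hS (QuotientGroup.mk (OpenSubgroupLayer.toAbove S H σ))
        (((Additive.toMul (layerModuleEquiv hHo E hF hS z) : sUnits K S ↥E.1) : (↥E.1)ˣ) : ↥E.1) : ↥E.1) :
          AlgebraicClosure K) = _
      rw [OpenSubgroupLayer.coe_layerEquiv_mk_toAbove, coe_layerModuleEquiv]
    exact lhs.trans rhs.symm

end LayerModule

/-! ### §3. The layer cohomology isomorphism -/

/-- **`Hⁿ(↥U ⧸ Gal(K_S/E), (Res_U E_S)^{Gal(K_S/E)}) ≅ Hⁿ(Gal(E/F₀), 𝒪_{E,S}ˣ)`** (Mathlib `groupCohomology.mapIso`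
along `layerEquiv` and `layerModuleEquiv`): the finite layers of `Hⁿ(U, E_S)` ARE the groups
`Hⁿ(Gal(E/F₀), 𝒪_{E,S}^×)` of NSW's proof of (8.3.18). [cite: NeukirchSchmidtWingberg2008, VIII §3, (8.3.11)]
[cite: SerreGaloisCohomology1997, I §2.2 Prop. 8] -/
def layerCohomologyIso (hHo : IsOpen (H : Set (absoluteGaloisGroup K))) (E : GalLayer K)
    (hF : OpenSubgroupLayer.baseField H ≤ E.1) (hS : ramificationSubgroup K S ≤ galFixing K E.1) (n : ℕ) :
    letI := OpenSubgroupLayer.algOfLE hF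
    groupCohomology (layerRep hHo E hF hS) n ≅ groupCohomology (sUnitsRep K S ↥(OpenSubgroupLayer.baseField H) ↥E.1) n :=
  letI := OpenSubgroupLayer.algOfLE hF
  groupCohomology.mapIso (OpenSubgroupLayer.layerEquiv S hHo E hF hS) (layerModuleEquiv hHo E hF hS)
    (layerModuleEquiv_comm hHo E hF hS) n

end Layers

end SUnits

end Literature.NumberTheory.GaloisRepresentations

end
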